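import Literature.Computability.AlgebraicComplexity.TensorOrbitZariskiClosure
import Literature.Computability.AlgebraicComplexity.BI17GenericTensorDegreeMonoidProofs
import Literature.Computability.AlgebraicComplexity.BI17PolystableTensorPeriodProofs
import Literature.Computability.AlgebraicComplexity.BI17TensorDegreeMonoidDivisibilityProofs
import Literature.Computability.AlgebraicComplexity.BI17SL3InvariantDimensionProofs
import Mathlib.RingTheory.IntegralClosure.IntegrallyClosed
import Mathlib.RingTheory.Localization.FractionRing
import HarnessLib

/-!
# BI 2017, Thm. 5.8 (3) — the non-normality mechanism for tensor orbit closures (Reynolds-free part)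

P. Bürgisser, C. Ikenmeyer, *Fundamental invariants of orbit closures*, J. Algebra **477** (2017)
390–434 = arXiv:1511.02927 [BurgisserIkenmeyer2017], Thm. 5.8 (3) (L2097, p0018:L150: "If
`m a(w) < e(w)`, that is, `1 < e'(w)`, then … `\overline{Gw}` is not a normal algebraic variety"),
"completely analogous to … Thm. 3.10", whose printed §6.3 argument (p0009:L22–27, p0024) the forms file
`BI17DegreeExponentMonoidProofs.lean` formalises as `not_isIntegrallyClosed_orbitCoordRing`.

This theorem-only file ports the ALGEBRAIC core of that argument to tensors
(`TensorOrbitCoordRing w = ℂ[⊗³] ⧸ I(Gw)`, exponent monoid `E'(w) = tensorExponentMonoid w` of the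
file of record `BI17FundamentalInvariantTensors.lean`):

* `not_isIntegrallyClosed_tensorOrbitCoordRing_of_consecutive` — if `k, k + 1 ∈ E'(w)` (`k ≥ 1`)
  but `1 ∉ E'(w)`, then `O(\overline{Gw})` is not integrally closed: with regular extensions
  `F_k`, `F_{k+1}` of `φ_w^k`, `φ_w^{k+1}` (`φ_w(g w) = χ(g)^{a(w)}`), the fraction `F_{k+1}/F_k`
  satisfies `(F_{k+1}/F_k)^k = F_k` in `Frac O(\overline{Gw})` (a domain:
  `isDomain_tensorOrbitCoordRing`), so it is integral; were it a class `H`, then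
  `H(g w) χ(g)^{a k} = χ(g)^{a(k+1)}`, i.e. `H` extends `φ_w` and `1 ∈ E'(w)`.

The remaining inputs of Thm. 5.8 (3) as typed (`BI2017_thm_5_8`) — "`E'(w)` generates `ℤ`", hence
contains consecutive integers (Thm. 5.3 with Lemma 5.1 (3), whose `⊇` halves need an `SL³`-Reynolds
operator), and `1 ∉ E'(w) ⟺ 1 < e'(w)` — are not proved here; section `Bridge` derives them BY NAME
from the named facts `BI2017_lem_5_1_3` and `BI2017_thm_5_3` (the subgroup computation of §6.2,
`exists_consecutive_mem_tensorExponentMonoid_of_closure_eq`, with `a(w) ≠ 0` from the tree's theorem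
`BI2017_polystableTensor_period_holds`), so that the non-normality clause of `BI2017_thm_5_8` is
reduced to those two facts: `BI2017_thm_5_8_nonNormal_of_lem_5_1_3_of_thm_5_3`. Section `Assembly`
does the same for the whole named fact: the exact semi-invariance
`IsSL3Invariant.aeval_tensorPt_actTensor_eq_tensorChi_pow` (`F(g·v) = χ(g)^n F(v)` for a homogeneous
`SL³`-invariant of degree `m n`), homogeneous invariant extensions `G_k` of `φ_w^k`
(`exists_isSL3Invariant_extension_of_eq`), the ideal-strictness clause by the printed §6.3 descent
(`BI2017_thm_5_8_idealStrict_of_lem_5_1_3_of_thm_5_3`; `G_k` vanishes on the boundary because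
`G_k^{e'} ≡ Φ_w^k` modulo `I(Gw)` and `Φ_w` does, Thm. 5.8 (1) = the tree's `BI2017_thm_5_8_part1_of_pos`),
and **`BI2017_thm_5_8_of_lem_5_1_3_of_thm_5_3 : BI2017_lem_5_1_3 → BI2017_thm_5_3 → BI2017_thm_5_8`**.
Section `ThmFiveEleven` treats the first clause of Thm. 5.11 ("`√m / a(w) ≤ e'(w)` if `m > 2`",
"analogous to Theorem 3.15") the same way: `e(w) = m a(w) e'(w) ∈ E(w) ⊆ E(m)` carries a nonzero
invariant, so `k_m(a e') > 0` (the tree's `genericTensorDegreeMonoid_eq_kronRect`) and `m ≤ (a e')²`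
(`le_sq_of_kronRect_pos`, the Kronecker length bound): `BI2017_thm_5_11_part1_of_lem_5_1_3_of_thm_5_3`;
and the second clause (`m = n²`: `a(w) e'(w) = n ↔ F_n(w) ≠ 0`, `Φ_w = F_n(w)⁻¹ F_n`) given moreover
`F_n ≠ 0` (the open half of Thm. 5.13): `O(⊗³ℂ^{n²})^{SL³}_{n³} = ℂ F_n` by `k_{n²}(n) = 1`
(`kronRect_sq_eq_one`) — `BI2017_thm_5_11_part2_of_lem_5_1_3_of_thm_5_3_of_ne_zero`, assembled as
`BI2017_thm_5_11_of_lem_5_1_3_of_thm_5_3_of_ne_zero`. No definitions, no named facts.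
Honest framing: one algebraic lemma about coordinate rings of tensor orbit closures; nothing here
bears on VP versus VNP.

## References

* [BurgisserIkenmeyer2017] P. Bürgisser, C. Ikenmeyer, *Fundamental invariants of orbit closures*,
  J. Algebra 477 (2017) 390–434; arXiv:1511.02927, Thm. 5.8 (3), Thm. 3.10 and §6.3.
-/

noncomputable section

open MvPolynomial

namespace Literature.Computability.AlgebraicComplexity

section NonNormal

variable {ι : Type*} [Fintype ι] [DecidableEq ι]

/-- **BI 2017, Thm. 5.8 (3), algebraic core — `\overline{Gw}` is not normal** as soon as the exponent
monoid `E'(w)` contains two consecutive positive integers `k, k+1` but not `1`: the fraction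
`F_{k+1}/F_k` of regular extensions of `φ_w^{k+1}`, `φ_w^k` is integral over `O(\overline{Gw})`
(`(F_{k+1}/F_k)^k = F_k`) but not in it (it would extend `φ_w`). The tensor twin of
`not_isIntegrallyClosed_orbitCoordRing`. [cite: BurgisserIkenmeyer2017, Thm. 5.8 (3)] -/
theorem not_isIntegrallyClosed_tensorOrbitCoordRing_of_consecutive (w : ι → ι → ι → ℂ) {k : ℕ}
    (hk0 : 0 < k) (hk : k ∈ tensorExponentMonoid w) (hk1 : k + 1 ∈ tensorExponentMonoid w)
    (h1 : 1 ∉ tensorExponentMonoid w) :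
    ¬ IsIntegrallyClosed (TensorOrbitCoordRing w) := by
  classical
  intro hIC
  apply h1
  obtain ⟨F₁, hF₁⟩ := hk
  obtain ⟨F₂, hF₂⟩ := hk1
  set a := tensorStabilizerPeriod w with ha
  set I := tensorOrbitVanishingIdeal w with hI
  haveI : IsDomain (TensorOrbitCoordRing w) := isDomain_tensorOrbitCoordRing w
  set R := TensorOrbitCoordRing w
  set K := FractionRing (TensorOrbitCoordRing w)
  -- `F₁ ∉ I(Gw)` (`F₁(w) = 1`)
  have hF₁I : Ideal.Quotient.mk I F₁ ≠ 0 := by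
    rw [Ne, Ideal.Quotient.eq_zero_iff_mem, hI, mem_tensorOrbitVanishingIdeal_iff, not_forall]
    refine ⟨1, ?_⟩
    rw [hF₁ 1]
    exact pow_ne_zero _ (Units.ne_zero _)
  have hF₁K : algebraMap R K (Ideal.Quotient.mk I F₁) ≠ 0 := fun h =>
    hF₁I ((IsFractionRing.to_map_eq_zero_iff (R := R) (K := K)).1 h)
  -- `F₂^k = F₁^(k+1)` in `O(\overline{Gw})`
  have hpow : (Ideal.Quotient.mk I F₂) ^ k = (Ideal.Quotient.mk I F₁) ^ (k + 1) := by
    rw [← map_pow, ← map_pow, Ideal.Quotient.eq, hI, mem_tensorOrbitVanishingIdeal_iff]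
    intro g
    rw [map_sub, map_pow, map_pow, hF₁ g, hF₂ g, ← pow_mul, ← pow_mul,
      show a * (k + 1) * k = a * k * (k + 1) by ring, sub_self]
  -- `r = F₂ / F₁` is integral: `r ^ k = F₁`
  set r : K := algebraMap R K (Ideal.Quotient.mk I F₂) / algebraMap R K (Ideal.Quotient.mk I F₁)
    with hr
  have hrk : r ^ k = algebraMap R K (Ideal.Quotient.mk I F₁) := by
    rw [hr, div_pow, ← map_pow, hpow, map_pow, pow_succ, mul_comm, mul_div_assoc,
      div_self (pow_ne_zero _ hF₁K), mul_one]
  have hint : IsIntegral R (r ^ k) := by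
    rw [hrk]
    exact isIntegral_algebraMap
  obtain ⟨y, hy⟩ := IsIntegrallyClosed.exists_algebraMap_eq_of_isIntegral_pow hk0 hint
  obtain ⟨H, rfl⟩ := Ideal.Quotient.mk_surjective y
  -- `H F₁ ≡ F₂` modulo `I(Gw)`, so `H` extends `φ_w`: `1 ∈ E'(w)`
  have hHF : Ideal.Quotient.mk I H * Ideal.Quotient.mk I F₁ = Ideal.Quotient.mk I F₂ := by
    apply IsFractionRing.injective R K
    rw [map_mul, hy, hr, div_mul_cancel₀ _ hF₁K]
  refine ⟨H, fun g => ?_⟩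
  rw [← map_mul, Ideal.Quotient.eq, hI, mem_tensorOrbitVanishingIdeal_iff] at hHF
  have := hHF g
  rw [map_sub, map_mul, hF₁ g, hF₂ g, sub_eq_zero, show a * (k + 1) = a * 1 + a * k by ring,
    pow_add] at this
  exact mul_right_cancel₀ (pow_ne_zero _ (Units.ne_zero _)) this

/-- The contrapositive packaging used by Thm. 5.8 (3): if `O(\overline{Gw})` IS integrally closed and
`E'(w)` contains consecutive positive integers, then `1 ∈ E'(w)` (so `e'(w) = 1`).
[cite: BurgisserIkenmeyer2017, Thm. 5.8 (3)] -/
theorem one_mem_tensorExponentMonoid_of_isIntegrallyClosed (w : ι → ι → ι → ℂ) {k : ℕ}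
    (hk0 : 0 < k) (hk : k ∈ tensorExponentMonoid w) (hk1 : k + 1 ∈ tensorExponentMonoid w)
    (hIC : IsIntegrallyClosed (TensorOrbitCoordRing w)) : 1 ∈ tensorExponentMonoid w := by
  by_contra h1
  exact not_isIntegrallyClosed_tensorOrbitCoordRing_of_consecutive w hk0 hk hk1 h1 hIC

end NonNormal

/-! ### The clause of `BI2017_thm_5_8` (3) from `BI2017_lem_5_1_3` and `BI2017_thm_5_3` by name -/

section Bridge

variable {ι : Type*} [Fintype ι] [DecidableEq ι]

/-- `0 ∈ E'(w)` (the constant `1` extends `φ_w^0`). [cite: BurgisserIkenmeyer2017, §5 (after Thm. 5.3)] -/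
theorem zero_mem_tensorExponentMonoid (w : ι → ι → ι → ℂ) : 0 ∈ tensorExponentMonoid w :=
  ⟨1, fun g => by rw [map_one, mul_zero, pow_zero]⟩

/-- `E'(w)` is closed under addition (products of regular extensions).
[cite: BurgisserIkenmeyer2017, §5 (after Thm. 5.3)] -/
theorem add_mem_tensorExponentMonoid {w : ι → ι → ι → ℂ} {e₁ e₂ : ℕ}
    (h₁ : e₁ ∈ tensorExponentMonoid w) (h₂ : e₂ ∈ tensorExponentMonoid w) :
    e₁ + e₂ ∈ tensorExponentMonoid w := by
  obtain ⟨F₁, hF₁⟩ := h₁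
  obtain ⟨F₂, hF₂⟩ := h₂
  exact ⟨F₁ * F₂, fun g => by rw [map_mul, hF₁, hF₂, ← pow_add, mul_add]⟩

/-- A positive element of `E'(w)` is at least `e'(w)`. [cite: BurgisserIkenmeyer2017, §5 (after Thm. 5.3)] -/
theorem tensorMinimalExponent_le_of_mem {w : ι → ι → ι → ℂ} {e : ℕ} (he : e ∈ tensorExponentMonoid w)
    (he0 : 0 < e) : tensorMinimalExponent w ≤ e :=
  Nat.sInf_le ⟨he, he0⟩

/-- **`E'(w)` contains two consecutive positive integers** whenever `E(w) ⊆ b · E'(w)` and `E(w)`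
generates the group `b ℤ` with `b ≠ 0` (the subgroup computation of BI 2017 §6.2, "the submonoid
`S ⊆ ℕ` generates the group `ℤ`"; for tensors `b = m a(w)`).
[cite: BurgisserIkenmeyer2017, Thm. 5.3 (proof, §6.4 with §6.2)] -/
theorem exists_consecutive_mem_tensorExponentMonoid_of_closure_eq (w : ι → ι → ι → ℂ) {b : ℕ}
    (hb0 : b ≠ 0)
    (hE : tensorDegreeMonoid w ⊆ (fun e => b * e) '' tensorExponentMonoid w)
    (hZ : AddSubgroup.closure ((fun d : ℕ => (d : ℤ)) '' tensorDegreeMonoid w) =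
      AddSubgroup.zmultiples (b : ℤ)) :
    ∃ k : ℕ, 0 < k ∧ k ∈ tensorExponentMonoid w ∧ k + 1 ∈ tensorExponentMonoid w := by
  -- the subgroup `b · (E'(w) − E'(w))` contains `⟨E(w)⟩ = bℤ`
  let T : AddSubgroup ℤ :=
    { carrier := {x | ∃ p ∈ tensorExponentMonoid w, ∃ q ∈ tensorExponentMonoid w,
        x = (b : ℤ) * ((p : ℤ) - (q : ℤ))}
      zero_mem' := ⟨0, zero_mem_tensorExponentMonoid w, 0, zero_mem_tensorExponentMonoid w, by simp⟩
      add_mem' := by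
        rintro _ _ ⟨p₁, hp₁, q₁, hq₁, rfl⟩ ⟨p₂, hp₂, q₂, hq₂, rfl⟩
        exact ⟨p₁ + p₂, add_mem_tensorExponentMonoid hp₁ hp₂, q₁ + q₂,
          add_mem_tensorExponentMonoid hq₁ hq₂, by push_cast; ring⟩
      neg_mem' := by
        rintro _ ⟨p, hp, q, hq, rfl⟩
        exact ⟨q, hq, p, hp, by ring⟩ }
  have hle : AddSubgroup.closure ((fun d : ℕ => (d : ℤ)) '' tensorDegreeMonoid w) ≤ T := by
    rw [AddSubgroup.closure_le]
    rintro _ ⟨d, hd, rfl⟩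
    obtain ⟨e, he, rfl⟩ := hE hd
    exact ⟨e, he, 0, zero_mem_tensorExponentMonoid w, by push_cast; ring⟩
  have hbT : (b : ℤ) ∈ T := by
    apply hle
    rw [hZ]
    exact AddSubgroup.mem_zmultiples _
  obtain ⟨p, hp, q, hq, hpq⟩ := hbT
  have h1 : (p : ℤ) - q = 1 := by
    have hb0' : (b : ℤ) ≠ 0 := by exact_mod_cast hb0
    have : (b : ℤ) * 1 = (b : ℤ) * ((p : ℤ) - q) := by
      rw [mul_one]; exact hpq
    exact (mul_left_cancel₀ hb0' this).symm
  have hp1 : p = q + 1 := by omega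
  -- `2q + 1, 2q + 2 ∈ E'(w)`
  refine ⟨q + q + 1, by omega, ?_, ?_⟩
  · rw [add_assoc, ← hp1]
    exact add_mem_tensorExponentMonoid hq hp
  · rw [show q + q + 1 + 1 = (q + 1) + (q + 1) by ring, ← hp1]
    exact add_mem_tensorExponentMonoid hp hp

/-- **BI 2017, Thm. 5.8 (3), "`\overline{Gw}` is not a normal algebraic variety" if
`m a(w) < e(w)`**, reduced BY NAME to the named facts `BI2017_lem_5_1_3` (`E(w) = m a(w) E'(w)`,
`e(w) = m a(w) e'(w)`) and `BI2017_thm_5_3` (`E(w)` generates `m a(w) ℤ`): then `e'(w) > 1`, so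
`1 ∉ E'(w)`, while `E'(w)` contains consecutive integers; conclude by
`not_isIntegrallyClosed_tensorOrbitCoordRing_of_consecutive`. (`a(w) ≠ 0` is the tree's theorem
`BI2017_polystableTensor_period_holds`.) [cite: BurgisserIkenmeyer2017, Thm. 5.8 (3)] -/
theorem BI2017_thm_5_8_nonNormal_of_lem_5_1_3_of_thm_5_3 (h513 : BI2017_lem_5_1_3)
    (h53 : BI2017_thm_5_3) (m : ℕ) (w : Fin m → Fin m → Fin m → ℂ) (hw : w ≠ 0)
    (hps : IsPolystableTensor w) (hlt : m * tensorStabilizerPeriod w < tensorMinimalDegree w) :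
    ¬ IsIntegrallyClosed (TensorOrbitCoordRing w) := by
  obtain ⟨hE, he⟩ := h513 m w hw hps
  have hZ := h53 m w hw hps
  have ha0 : tensorStabilizerPeriod w ≠ 0 := BI2017_polystableTensor_period_holds m w hw hps
  have hm0 : m ≠ 0 := by
    rintro rfl
    exact hw (funext fun a => Fin.elim0 a)
  have hb0 : m * tensorStabilizerPeriod w ≠ 0 := mul_ne_zero hm0 ha0
  -- `e'(w) > 1`, hence `1 ∉ E'(w)`
  have he1 : 1 < tensorMinimalExponent w := by
    by_contra h
    push Not at h
    rw [he] at hlt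
    exact absurd hlt (not_lt.2 ((Nat.mul_le_mul_left _ h).trans (by rw [mul_one])))
  have h1 : 1 ∉ tensorExponentMonoid w := fun h =>
    absurd (tensorMinimalExponent_le_of_mem h one_pos) (not_le.2 he1)
  obtain ⟨k, hk0, hk, hk1⟩ :=
    exists_consecutive_mem_tensorExponentMonoid_of_closure_eq w hb0 hE.le hZ
  exact not_isIntegrallyClosed_tensorOrbitCoordRing_of_consecutive w hk0 hk hk1 h1

end Bridge

/-! ### The whole of `BI2017_thm_5_8` from `BI2017_lem_5_1_3` and `BI2017_thm_5_3` -/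

section Assembly

open Filter Topology

variable {ι : Type*} [Fintype ι] [DecidableEq ι]

/-- `GL = (ℂ^× · 1) · SL`: `u = t • s` with `s ∈ SL` for any prescribed root `t^m = det u`. [folklore] -/
private theorem exists_sl_eq_smul'' (u : GL ι ℂ) {t : ℂ} (ht0 : t ≠ 0)
    (ht : t ^ Fintype.card ι = (u : Matrix ι ι ℂ).det) :
    ∃ s : Matrix.SpecialLinearGroup ι ℂ, (u : Matrix ι ι ℂ) = t • (s : Matrix ι ι ℂ) := by
  refine ⟨⟨t⁻¹ • (u : Matrix ι ι ℂ), ?_⟩, ?_⟩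
  · rw [Matrix.det_smul, ← ht, inv_pow, inv_mul_cancel₀ (pow_ne_zero _ ht0)]
  · change (u : Matrix ι ι ℂ) = t • (t⁻¹ • (u : Matrix ι ι ℂ))
    rw [smul_smul, mul_inv_cancel₀ ht0, one_smul]

/-- **Exact semi-invariance of `SL³`-invariants**: a homogeneous `SL³`-invariant `F` of degree `m n`
(`m = |ι|`) satisfies `F((g₁ ⊗ g₂ ⊗ g₃) v) = χ(g)^n F(v)`, `χ(g) = det g₁ det g₂ det g₃` (writing
`gᵢ = tᵢ sᵢ`, `tᵢ^m = det gᵢ`, `sᵢ ∈ SL`: "`ι(t) w = t w` … hence `m a(w)` equals the degree", Lemma 5.1).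
[cite: BurgisserIkenmeyer2017, Lemma 5.1 (proof)] -/
theorem IsSL3Invariant.aeval_tensorPt_actTensor_eq_tensorChi_pow [Nonempty ι]
    {F : MvPolynomial (ι × ι × ι) ℂ} {n : ℕ} (hF : F.IsHomogeneous (Fintype.card ι * n))
    (hinv : IsSL3Invariant F) (g : GL ι ℂ × GL ι ℂ × GL ι ℂ) (v : ι → ι → ι → ℂ) :
    aeval (tensorPt (actTensor (g.1 : Matrix ι ι ℂ) (g.2.1 : Matrix ι ι ℂ) (g.2.2 : Matrix ι ι ℂ) v))
        F = ((tensorChi g : ℂˣ) : ℂ) ^ n * aeval (tensorPt v) F := by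
  have hm : 0 < Fintype.card ι := Fintype.card_pos
  have hdet : ∀ u : GL ι ℂ, (u : Matrix ι ι ℂ).det ≠ 0 := fun u => by
    rw [← Matrix.GeneralLinearGroup.val_det_apply]; exact Units.ne_zero _
  obtain ⟨t₁, ht₁⟩ := IsAlgClosed.exists_pow_nat_eq (g.1 : Matrix ι ι ℂ).det hm
  obtain ⟨t₂, ht₂⟩ := IsAlgClosed.exists_pow_nat_eq (g.2.1 : Matrix ι ι ℂ).det hm
  obtain ⟨t₃, ht₃⟩ := IsAlgClosed.exists_pow_nat_eq (g.2.2 : Matrix ι ι ℂ).det hm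
  have ht₁0 : t₁ ≠ 0 := by rintro rfl; rw [zero_pow hm.ne'] at ht₁; exact hdet _ ht₁.symm
  have ht₂0 : t₂ ≠ 0 := by rintro rfl; rw [zero_pow hm.ne'] at ht₂; exact hdet _ ht₂.symm
  have ht₃0 : t₃ ≠ 0 := by rintro rfl; rw [zero_pow hm.ne'] at ht₃; exact hdet _ ht₃.symm
  obtain ⟨s₁, hs₁⟩ := exists_sl_eq_smul'' g.1 ht₁0 ht₁
  obtain ⟨s₂, hs₂⟩ := exists_sl_eq_smul'' g.2.1 ht₂0 ht₂
  obtain ⟨s₃, hs₃⟩ := exists_sl_eq_smul'' g.2.2 ht₃0 ht₃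
  have hchi : ((tensorChi g : ℂˣ) : ℂ) ^ n = (t₁ * t₂ * t₃) ^ (Fintype.card ι * n) := by
    simp only [tensorChi, Units.val_mul, Matrix.GeneralLinearGroup.val_det_apply]
    rw [← ht₁, ← ht₂, ← ht₃]
    ring
  rw [hs₁, hs₂, hs₃, actTensor_eq_tripleAct, tripleAct_smul, ← actTensor_eq_tripleAct,
    show tensorPt ((t₁ * t₂ * t₃) • actTensor (s₁ : Matrix ι ι ℂ) (s₂ : Matrix ι ι ℂ)
        (s₃ : Matrix ι ι ℂ) v) =
      (t₁ * t₂ * t₃) • tensorPt (actTensor (s₁ : Matrix ι ι ℂ) (s₂ : Matrix ι ι ℂ) (s₃ : Matrix ι ι ℂ) v)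
      from rfl]
  simp only [MvPolynomial.aeval_eq_eval]
  rw [hF.eval_smul_eq, ← MvPolynomial.aeval_eq_eval, ← MvPolynomial.aeval_eq_eval, hinv s₁ s₂ s₃ v,
    hchi]

/-- **Homogeneous `SL³`-invariant extensions of `φ_w^k`**: if `E(w) = b · E'(w)` with `b = m a(w)`
(Lemma 5.1 (3)), then every `k ∈ E'(w)` has a homogeneous `SL³`-invariant `G` of degree `b k` with
`G(g w) = χ(g)^{a(w) k}` for all `g ∈ GL³`. [cite: BurgisserIkenmeyer2017, Lemma 5.1 (3)] -/
theorem exists_isSL3Invariant_extension_of_eq [Nonempty ι] (w : ι → ι → ι → ℂ)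
    (hE : tensorDegreeMonoid w =
      (fun e => Fintype.card ι * tensorStabilizerPeriod w * e) '' tensorExponentMonoid w)
    {k : ℕ} (hk : k ∈ tensorExponentMonoid w) :
    ∃ G : MvPolynomial (ι × ι × ι) ℂ,
      G.IsHomogeneous (Fintype.card ι * tensorStabilizerPeriod w * k) ∧ IsSL3Invariant G ∧
      ∀ g : GL ι ℂ × GL ι ℂ × GL ι ℂ,
        aeval (tensorPt (actTensor (g.1 : Matrix ι ι ℂ) (g.2.1 : Matrix ι ι ℂ)
          (g.2.2 : Matrix ι ι ℂ) w)) G =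
          ((tensorChi g : ℂˣ) : ℂ) ^ (tensorStabilizerPeriod w * k) := by
  have hmem : Fintype.card ι * tensorStabilizerPeriod w * k ∈ tensorDegreeMonoid w := by
    rw [hE]
    exact ⟨k, hk, rfl⟩
  obtain ⟨G, hGh, hGi, hGI⟩ := hmem
  have hGw := aeval_tensorPt_ne_zero_of_not_mem_tensorOrbitVanishingIdeal hGh hGi hGI
  have hGh' : G.IsHomogeneous (Fintype.card ι * (tensorStabilizerPeriod w * k)) := by
    rw [← mul_assoc]; exact hGh
  refine ⟨(aeval (tensorPt w) G)⁻¹ • G, ?_, ?_, fun g => ?_⟩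
  · rw [smul_eq_C_mul]
    exact hGh.C_mul _
  · exact (sl3InvariantSubmodule ι ℂ).smul_mem _ hGi
  · rw [map_smul, hGi.aeval_tensorPt_actTensor_eq_tensorChi_pow hGh' g w, smul_eq_mul,
      mul_left_comm, inv_mul_cancel₀ hGw, mul_one]

/-- The degree monoid of a tensor whose `E(w)` generates `b ℤ`, `b ≠ 0`, has a positive element, so
`e(w) ∈ E(w)` and `e(w) > 0`. [cite: BurgisserIkenmeyer2017, Def. 5.2] -/
theorem tensorMinimalDegree_pos_of_closure_eq (w : ι → ι → ι → ℂ) {b : ℕ} (hb0 : b ≠ 0)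
    (hZ : AddSubgroup.closure ((fun d : ℕ => (d : ℤ)) '' tensorDegreeMonoid w) =
      AddSubgroup.zmultiples (b : ℤ)) :
    tensorMinimalDegree w ∈ tensorDegreeMonoid w ∧ 0 < tensorMinimalDegree w := by
  have hne : ({d | d ∈ tensorDegreeMonoid w ∧ 0 < d} : Set ℕ).Nonempty := by
    by_contra h
    rw [Set.not_nonempty_iff_eq_empty] at h
    have hle : AddSubgroup.closure ((fun d : ℕ => (d : ℤ)) '' tensorDegreeMonoid w) ≤ ⊥ := by
      rw [AddSubgroup.closure_le]
      rintro _ ⟨d, hd, rfl⟩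
      have hd0 : d = 0 := by
        by_contra hd0
        have : d ∈ ({d | d ∈ tensorDegreeMonoid w ∧ 0 < d} : Set ℕ) := ⟨hd, Nat.pos_of_ne_zero hd0⟩
        rw [h] at this
        exact this
      simp [hd0]
    have hb : (b : ℤ) ∈ (⊥ : AddSubgroup ℤ) := hle (by rw [hZ]; exact AddSubgroup.mem_zmultiples _)
    rw [AddSubgroup.mem_bot] at hb
    exact hb0 (by exact_mod_cast hb)
  exact Nat.sInf_mem hne

/-- `Φ_w(g w) = χ(g)^{a(w) e'(w)}` for a polynomial representing the fundamental invariant, when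
`e(w) = m a(w) e'(w)` ("`Φ_w = (φ_w)^{e'(w)}` on `Gw`"). [cite: BurgisserIkenmeyer2017, Def. 5.7] -/
theorem IsTensorFundamentalInvariant.aeval_tensorPt_actTensor_of_eq [Nonempty ι] {w : ι → ι → ι → ℂ}
    {Φ : MvPolynomial (ι × ι × ι) ℂ} (hΦ : IsTensorFundamentalInvariant w Φ)
    (he : tensorMinimalDegree w = Fintype.card ι * tensorStabilizerPeriod w * tensorMinimalExponent w)
    (g : GL ι ℂ × GL ι ℂ × GL ι ℂ) :
    aeval (tensorPt (actTensor (g.1 : Matrix ι ι ℂ) (g.2.1 : Matrix ι ι ℂ) (g.2.2 : Matrix ι ι ℂ) w))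
        Φ = ((tensorChi g : ℂˣ) : ℂ) ^ (tensorStabilizerPeriod w * tensorMinimalExponent w) := by
  obtain ⟨hΦh, hΦi, hΦw⟩ := hΦ
  rw [he, mul_assoc] at hΦh
  rw [hΦi.aeval_tensorPt_actTensor_eq_tensorChi_pow hΦh g w, hΦw, mul_one]

/-- **BI 2017, Thm. 5.8 (3), first clause — the boundary ideal strictly exceeds
`Φ_w O(\overline{Gw})` if `m a(w) < e(w)`**, reduced BY NAME to `BI2017_lem_5_1_3` and `BI2017_thm_5_3`
(the printed §6.3 descent: `Φ_w` vanishes on the boundary by Thm. 5.8 (1); if it generated the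
boundary ideal, each homogeneous invariant extension `G_k` of `φ_w^k` — which vanishes on the
boundary since `G_k^{e'} ≡ Φ_w^k` modulo `I(Gw)` — would be `≡ H Φ_w`, so `k − e'(w) ∈ E'(w)`, absurd
for the least positive `k ∈ E'(w)` not divisible by `e'(w) > 1`).
[cite: BurgisserIkenmeyer2017, Thm. 5.8 (3)] -/
theorem BI2017_thm_5_8_idealStrict_of_lem_5_1_3_of_thm_5_3 (h513 : BI2017_lem_5_1_3)
    (h53 : BI2017_thm_5_3) (m : ℕ) (w : Fin m → Fin m → Fin m → ℂ)
    (Φ : MvPolynomial (Fin m × Fin m × Fin m) ℂ) (hw : w ≠ 0) (hps : IsPolystableTensor w)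
    (hΦ : IsTensorFundamentalInvariant w Φ) (hlt : m * tensorStabilizerPeriod w < tensorMinimalDegree w) :
    Ideal.span {Ideal.Quotient.mk (tensorOrbitVanishingIdeal w) Φ} <
      (tensorBoundaryVanishingIdeal w).map (Ideal.Quotient.mk (tensorOrbitVanishingIdeal w)) := by
  classical
  have hm0 : m ≠ 0 := by
    rintro rfl
    exact hw (funext fun a => Fin.elim0 a)
  haveI : Nonempty (Fin m) := ⟨⟨0, Nat.pos_of_ne_zero hm0⟩⟩
  obtain ⟨hE, he⟩ := h513 m w hw hps
  have hZ := h53 m w hw hps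
  have ha0 : tensorStabilizerPeriod w ≠ 0 := BI2017_polystableTensor_period_holds m w hw hps
  set a := tensorStabilizerPeriod w with ha
  set b := m * tensorStabilizerPeriod w with hb
  set e' := tensorMinimalExponent w with he'
  set I := tensorOrbitVanishingIdeal w with hI
  have hb0 : b ≠ 0 := mul_ne_zero hm0 ha0
  have hbpos : 0 < b := Nat.pos_of_ne_zero hb0
  have hcard : Fintype.card (Fin m) = m := Fintype.card_fin m
  have hE' : tensorDegreeMonoid w =
      (fun e => Fintype.card (Fin m) * tensorStabilizerPeriod w * e) '' tensorExponentMonoid w := by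
    rw [hcard]; exact hE
  have heCard : tensorMinimalDegree w =
      Fintype.card (Fin m) * tensorStabilizerPeriod w * tensorMinimalExponent w := by
    rw [hcard]; exact he
  have hepos : 0 < tensorMinimalDegree w := (tensorMinimalDegree_pos_of_closure_eq w hb0 hZ).2
  have he'1 : 1 < e' := by
    by_contra h
    push Not at h
    have : tensorMinimalDegree w ≤ b := by
      rw [he]; exact (Nat.mul_le_mul_left _ h).trans (by rw [mul_one])
    omega
  have he'0 : 0 < e' := by omega
  -- `Φ(g w) = χ(g)^{a e'}` and `Φ` vanishes on the boundary (Thm. 5.8 (1))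
  have hΦval := hΦ.aeval_tensorPt_actTensor_of_eq heCard
  have hΦvan : ∀ v ∈ closure (tensorGLOrbit w) \ tensorGLOrbit w, aeval (tensorPt v) Φ = 0 :=
    fun v hv => (BI2017_thm_5_8_part1_of_pos w Φ hps hΦ hepos v hv.1).2 hv.2
  -- the extensions `G_k` (`k > 0`) vanish on the boundary: `G_k^{e'} ≡ Φ^k` modulo `I(Gw)`
  have hvan : ∀ {G : MvPolynomial (Fin m × Fin m × Fin m) ℂ} {k : ℕ}, 0 < k →
      (∀ g : GL (Fin m) ℂ × GL (Fin m) ℂ × GL (Fin m) ℂ,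
        aeval (tensorPt (actTensor (g.1 : Matrix (Fin m) (Fin m) ℂ) (g.2.1 : Matrix (Fin m) (Fin m) ℂ)
          (g.2.2 : Matrix (Fin m) (Fin m) ℂ) w)) G = ((tensorChi g : ℂˣ) : ℂ) ^ (a * k)) →
      G ∈ tensorBoundaryVanishingIdeal w := by
    intro G k hk0 hG
    rw [tensorBoundaryVanishingIdeal, MvPolynomial.mem_vanishingIdeal_iff]
    rintro _ ⟨v, hv, rfl⟩
    have hdiff : G ^ e' - Φ ^ k ∈ tensorOrbitVanishingIdeal w := by
      rw [mem_tensorOrbitVanishingIdeal_iff]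
      intro g
      rw [map_sub, map_pow, map_pow, hG g, hΦval g, ← pow_mul, ← pow_mul,
        show a * k * e' = a * e' * k by ring, sub_self]
    have h0 := (mem_closure_tensorGLOrbit_iff w v).1 hv.1 _ hdiff
    rw [map_sub, map_pow, map_pow, hΦvan v hv, zero_pow hk0.ne', sub_zero] at h0
    exact (pow_eq_zero_iff he'0.ne').1 h0
  refine lt_of_le_of_ne ?_ fun hEQ => ?_
  · rw [Ideal.span_le, Set.singleton_subset_iff]
    refine Ideal.mem_map_of_mem _ ?_
    rw [tensorBoundaryVanishingIdeal, MvPolynomial.mem_vanishingIdeal_iff]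
    rintro _ ⟨v, hv, rfl⟩
    exact hΦvan v hv
  -- the least positive `k ∈ E'(w)` not divisible by `e'`
  obtain ⟨k₀, hk₀0, hk₀, hk₀1⟩ :=
    exists_consecutive_mem_tensorExponentMonoid_of_closure_eq w hb0 hE.le hZ
  set S : Set ℕ := {k | k ∈ tensorExponentMonoid w ∧ 0 < k ∧ ¬ e' ∣ k} with hS
  have hSne : S.Nonempty := by
    by_cases h : e' ∣ k₀
    · refine ⟨k₀ + 1, hk₀1, Nat.succ_pos _, fun h' => ?_⟩
      have : e' ∣ 1 := (Nat.dvd_add_right h).1 h'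
      exact absurd (Nat.le_of_dvd one_pos this) (not_le.2 he'1)
    · exact ⟨k₀, hk₀, hk₀0, h⟩
  obtain ⟨hkE, hk0, hkdvd⟩ := Nat.sInf_mem hSne
  set k := sInf S with hk
  -- `G_k ≡ H · Φ` modulo `I(Gw)`
  obtain ⟨G, -, -, hGval⟩ := exists_isSL3Invariant_extension_of_eq w hE' hkE
  have hGmem : Ideal.Quotient.mk I G ∈ Ideal.span {Ideal.Quotient.mk I Φ} := by
    rw [hEQ]
    exact Ideal.mem_map_of_mem _ (hvan hk0 hGval)
  obtain ⟨y, hy⟩ := Ideal.mem_span_singleton'.1 hGmem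
  obtain ⟨H, rfl⟩ := Ideal.Quotient.mk_surjective y
  rw [← map_mul, Ideal.Quotient.eq, hI, mem_tensorOrbitVanishingIdeal_iff] at hy
  -- `k ≥ e'`, and `H` extends `φ_w^{k - e'}`
  have hke : e' ≤ k := tensorMinimalExponent_le_of_mem hkE hk0
  have hmem : k - e' ∈ tensorExponentMonoid w := by
    refine ⟨H, fun g => ?_⟩
    have := hy g
    rw [map_sub, map_mul, hGval g, hΦval g, sub_eq_zero,
      show a * k = a * (k - e') + a * e' by rw [← mul_add, Nat.sub_add_cancel hke], pow_add] at this
    exact mul_right_cancel₀ (pow_ne_zero _ (Units.ne_zero _)) this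
  -- descent
  have hlt' : e' < k := lt_of_le_of_ne hke fun h => hkdvd (h ▸ dvd_rfl)
  have hmemS : k - e' ∈ S := by
    refine ⟨hmem, Nat.sub_pos_of_lt hlt', fun h => hkdvd ?_⟩
    have := Nat.dvd_add h (dvd_refl e')
    rwa [Nat.sub_add_cancel hke] at this
  have := Nat.sInf_le hmemS
  omega

/-- **BI 2017, Thm. 5.8, REDUCED BY NAME to `BI2017_lem_5_1_3` and `BI2017_thm_5_3`**: part (1) is the
tree's `BI2017_thm_5_8_part1_of_pos` (`e(w) > 0` because `E(w)` generates `m a(w) ℤ ≠ 0`), part (3)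
is `BI2017_thm_5_8_idealStrict_of_lem_5_1_3_of_thm_5_3` and
`BI2017_thm_5_8_nonNormal_of_lem_5_1_3_of_thm_5_3`. [cite: BurgisserIkenmeyer2017, Thm. 5.8] -/
theorem BI2017_thm_5_8_of_lem_5_1_3_of_thm_5_3 (h513 : BI2017_lem_5_1_3) (h53 : BI2017_thm_5_3) :
    BI2017_thm_5_8 := by
  intro m w Φ hw hps hΦ
  have hm0 : m ≠ 0 := by
    rintro rfl
    exact hw (funext fun a => Fin.elim0 a)
  haveI : Nonempty (Fin m) := ⟨⟨0, Nat.pos_of_ne_zero hm0⟩⟩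
  have ha0 : tensorStabilizerPeriod w ≠ 0 := BI2017_polystableTensor_period_holds m w hw hps
  have hepos : 0 < tensorMinimalDegree w :=
    (tensorMinimalDegree_pos_of_closure_eq w (mul_ne_zero hm0 ha0) (h53 m w hw hps)).2
  exact ⟨BI2017_thm_5_8_part1_of_pos w Φ hps hΦ hepos, fun hlt =>
    ⟨BI2017_thm_5_8_idealStrict_of_lem_5_1_3_of_thm_5_3 h513 h53 m w Φ hw hps hΦ hlt,
      BI2017_thm_5_8_nonNormal_of_lem_5_1_3_of_thm_5_3 h513 h53 m w hw hps hlt⟩⟩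

end Assembly

/-! ### Thm. 5.11, first clause, from `BI2017_lem_5_1_3` and `BI2017_thm_5_3` -/

section ThmFiveEleven

/-- **BI 2017, Thm. 5.11, first clause ("`√m / a(w) ≤ e'(w)` if `m > 2`", i.e.
`m ≤ (a(w) e'(w))²`), REDUCED BY NAME to `BI2017_lem_5_1_3` and `BI2017_thm_5_3`** ("analogous to
Theorem 3.15": the minimal degree `e(w) = m a(w) e'(w)` lies in `E(w) ⊆ E(m)`, so
`k_m(a(w) e'(w)) > 0` by the dimension formula, and `k_m(δ) = 0` for `δ² < m`). The printed `m > 2`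
is not needed for this clause. [cite: BurgisserIkenmeyer2017, Thm. 5.11] -/
theorem BI2017_thm_5_11_part1_of_lem_5_1_3_of_thm_5_3 (h513 : BI2017_lem_5_1_3)
    (h53 : BI2017_thm_5_3) (m : ℕ) (w : Fin m → Fin m → Fin m → ℂ) (hw : w ≠ 0)
    (hps : IsPolystableTensor w) :
    m ≤ (tensorStabilizerPeriod w * tensorMinimalExponent w) ^ 2 := by
  have hm0 : m ≠ 0 := by
    rintro rfl
    exact hw (funext fun a => Fin.elim0 a)
  obtain ⟨-, he⟩ := h513 m w hw hps
  have ha0 : tensorStabilizerPeriod w ≠ 0 := BI2017_polystableTensor_period_holds m w hw hps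
  obtain ⟨hmem, hepos⟩ :=
    tensorMinimalDegree_pos_of_closure_eq w (mul_ne_zero hm0 ha0) (h53 m w hw hps)
  set δ := tensorStabilizerPeriod w * tensorMinimalExponent w with hδ
  have heδ : tensorMinimalDegree w = m * δ := by rw [he, hδ, mul_assoc]
  have hδ0 : 0 < δ := by
    rcases Nat.eq_zero_or_pos δ with h | h
    · rw [heδ, h, mul_zero] at hepos; exact absurd hepos (lt_irrefl 0)
    · exact h
  have hgen := tensorDegreeMonoid_subset_genericTensorDegreeMonoid w hmem
  rw [genericTensorDegreeMonoid_eq_kronRect m, heδ] at hgen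
  obtain ⟨δ', hδ', hk⟩ := hgen
  have hδδ' : δ = δ' := Nat.eq_of_mul_eq_mul_left (Nat.pos_of_ne_zero hm0) hδ'
  rw [← hδδ'] at hk
  exact le_sq_of_kronRect_pos ℂ hδ0 hk

/-- `F_n(w) ≠ 0` puts `n³` into the degree monoid `E(w)` (`F_n` is a homogeneous `SL³`-invariant of
degree `n³`, `w ∈ Gw`). [cite: BurgisserIkenmeyer2017, Thm. 5.11 (proof)] -/
theorem pow_three_mem_tensorDegreeMonoid_of_aeval_fundInvariantTensor_ne_zero (n : ℕ)
    (w : Fin (n * n) → Fin (n * n) → Fin (n * n) → ℂ)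
    (h : aeval (tensorPt w) (fundInvariantTensor n ℂ) ≠ 0) : n ^ 3 ∈ tensorDegreeMonoid w := by
  refine ⟨fundInvariantTensor n ℂ, fundInvariantTensor_isHomogeneous n ℂ,
    isSL3Invariant_fundInvariantTensor n, fun hI => h ?_⟩
  have h1 := mem_tensorOrbitVanishingIdeal_iff.1 hI 1
  simpa only [Prod.fst_one, Prod.snd_one, Units.val_one, actTensor_one] using h1

/-- **BI 2017, Thm. 5.11, second clause ("if `m = n²`, we have equality iff `F_n(w) ≠ 0`. In this
case, we have `Φ_w = F_n(w)⁻¹ F_n`"), REDUCED BY NAME to `BI2017_lem_5_1_3`, `BI2017_thm_5_3` and the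
nonvanishing `F_n ≠ 0`** (Thm. 5.13): with `e(w) = n² a e'`, `a e' ≥ n` (first clause); `F_n(w) ≠ 0`
gives `n³ ∈ E(w)`, so `a e' ≤ n`; conversely `a e' = n` gives a degree-`n³` invariant `G` with
`G(w) ≠ 0`, and `O(⊗³ℂ^{n²})^{SL³}_{n³} = ℂ F_n` (`k_{n²}(n) = 1`, `kronRect_sq_eq_one`, `F_n ≠ 0`) forces
`F_n(w) ≠ 0`. [cite: BurgisserIkenmeyer2017, Thm. 5.11] -/
theorem BI2017_thm_5_11_part2_of_lem_5_1_3_of_thm_5_3_of_ne_zero (h513 : BI2017_lem_5_1_3)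
    (h53 : BI2017_thm_5_3) (n : ℕ) (hn : 1 ≤ n) (hF : fundInvariantTensor n ℂ ≠ 0)
    (w : Fin (n * n) → Fin (n * n) → Fin (n * n) → ℂ) (hw : w ≠ 0) (hps : IsPolystableTensor w) :
    (tensorStabilizerPeriod w * tensorMinimalExponent w = n ↔
      aeval (tensorPt w) (fundInvariantTensor n ℂ) ≠ 0) ∧
    (aeval (tensorPt w) (fundInvariantTensor n ℂ) ≠ 0 →
      IsTensorFundamentalInvariant w
        (C (aeval (tensorPt w) (fundInvariantTensor n ℂ))⁻¹ * fundInvariantTensor n ℂ)) := by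
  classical
  have hm0 : n * n ≠ 0 := Nat.mul_ne_zero (by omega) (by omega)
  obtain ⟨-, he⟩ := h513 (n * n) w hw hps
  have ha0 : tensorStabilizerPeriod w ≠ 0 := BI2017_polystableTensor_period_holds (n * n) w hw hps
  obtain ⟨hmem, hepos⟩ :=
    tensorMinimalDegree_pos_of_closure_eq w (mul_ne_zero hm0 ha0) (h53 (n * n) w hw hps)
  set δ := tensorStabilizerPeriod w * tensorMinimalExponent w with hδ
  have heδ : tensorMinimalDegree w = n * n * δ := by rw [he, hδ, mul_assoc]
  have hnδ : n ≤ δ := by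
    have h1 := BI2017_thm_5_11_part1_of_lem_5_1_3_of_thm_5_3 h513 h53 (n * n) w hw hps
    rw [← hδ, sq] at h1
    exact Nat.mul_self_le_mul_self_iff.1 h1
  have hn3 : n ^ 3 = n * n * n := by ring
  -- `F_n(w) ≠ 0 ⇒ δ ≤ n`
  have key1 : aeval (tensorPt w) (fundInvariantTensor n ℂ) ≠ 0 → δ = n := by
    intro h
    have hmem3 := pow_three_mem_tensorDegreeMonoid_of_aeval_fundInvariantTensor_ne_zero n w h
    have hle : tensorMinimalDegree w ≤ n ^ 3 :=
      Nat.sInf_le ⟨hmem3, pow_pos (by omega) 3⟩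
    rw [heδ, hn3] at hle
    exact le_antisymm (Nat.le_of_mul_le_mul_left hle (Nat.pos_of_ne_zero hm0)) hnδ
  -- `δ = n ⇒ F_n(w) ≠ 0`
  have key2 : δ = n → aeval (tensorPt w) (fundInvariantTensor n ℂ) ≠ 0 := by
    intro hδn
    rw [hδn, ← hn3] at heδ
    rw [heδ] at hmem
    obtain ⟨G, hGh, hGi, hGI⟩ := hmem
    have hGw := aeval_tensorPt_ne_zero_of_not_mem_tensorOrbitVanishingIdeal hGh hGi hGI
    -- `G` and `F_n` lie in the one-dimensional space `O(⊗³ℂ^{n²})^{SL³}_{n³}`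
    have hGmem : G ∈ sl3InvariantsOfDegree (Fin (n * n)) ℂ (n * n * n) :=
      (mem_sl3InvariantsOfDegree_iff _ _).2 ⟨hn3 ▸ hGh, hGi⟩
    have hFmem : fundInvariantTensor n ℂ ∈ sl3InvariantsOfDegree (Fin (n * n)) ℂ (n * n * n) :=
      hn3 ▸ fundInvariantTensor_mem_sl3InvariantsOfDegree n
    have hdim : Module.finrank ℂ (sl3InvariantsOfDegree (Fin (n * n)) ℂ (n * n * n)) = 1 := by
      rw [finrank_sl3InvariantsOfDegree_eq_kronRect, kronRect_sq_eq_one]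
    have hF0 : (⟨fundInvariantTensor n ℂ, hFmem⟩ : sl3InvariantsOfDegree (Fin (n * n)) ℂ (n * n * n)) ≠ 0 :=
      fun h0 => hF (congrArg Subtype.val h0)
    obtain ⟨c, hc⟩ := (finrank_eq_one_iff_of_nonzero' _ hF0).1 hdim ⟨G, hGmem⟩
    have hcG : c • fundInvariantTensor n ℂ = G := congrArg Subtype.val hc
    intro hFw
    apply hGw
    rw [← hcG, map_smul, hFw, smul_zero]
  refine ⟨⟨fun h => key2 h, fun h => key1 h⟩, fun hFw => ?_⟩
  have hδn := key1 hFw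
  refine ⟨?_, ?_, ?_⟩
  · rw [heδ, hδn, ← hn3]
    exact (fundInvariantTensor_isHomogeneous n ℂ).C_mul _
  · intro g₁ g₂ g₃ v
    rw [map_mul, map_mul, aeval_C, aeval_C, isSL3Invariant_fundInvariantTensor n g₁ g₂ g₃ v]
  · rw [map_mul, aeval_C, Algebra.algebraMap_self_apply, inv_mul_cancel₀ hFw]

/-- **BI 2017, Thm. 5.11 (whole named fact) from `BI2017_lem_5_1_3`, `BI2017_thm_5_3` and
`F_n ≠ 0` for all `n ≥ 1`** (the latter = the open half of the named fact `BI2017_thm_5_13`).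
[cite: BurgisserIkenmeyer2017, Thm. 5.11] -/
theorem BI2017_thm_5_11_of_lem_5_1_3_of_thm_5_3_of_ne_zero (h513 : BI2017_lem_5_1_3)
    (h53 : BI2017_thm_5_3) (hF : ∀ n : ℕ, 1 ≤ n → fundInvariantTensor n ℂ ≠ 0) : BI2017_thm_5_11 :=
  ⟨fun m w _ hw hps => BI2017_thm_5_11_part1_of_lem_5_1_3_of_thm_5_3 h513 h53 m w hw hps,
    fun n w hn hw hps =>
      BI2017_thm_5_11_part2_of_lem_5_1_3_of_thm_5_3_of_ne_zero h513 h53 n (by omega) (hF n (by omega))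
        w hw hps⟩

end ThmFiveEleven

end Literature.Computability.AlgebraicComplexity

end
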